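import Literature.AnabelianGeometry.EtaleTheta.TemperedCoverings
import Literature.AnabelianGeometry.EtaleTheta.Discharge.Sec3TemperedFilterWitness
import Literature.AnabelianGeometry.AbsoluteAnabelian.FreeProSigmaNonVacuity
import Literature.AnabelianGeometry.AbsoluteAnabelian.FreeProSigmaCompletionBridge
import Literature.AnabelianGeometry.AbsoluteAnabelian.GaloisSubextensionProofs
import Literature.AnabelianGeometry.SemiGraphs.OncePuncturedTemperedGroupWitness
import Literature.AnabelianGeometry.SemiGraphs.TemperedSpecialFibreTowerFreeProfiniteWitness
import Literature.AnabelianGeometry.SemiGraphs.TemperedDecompositionCompact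
import Literature.AnabelianGeometry.SemiGraphs.TemperedGroups
import Mathlib.FieldTheory.IsAlgClosed.AlgebraicClosure
import HarnessLib

/-!
# [EtTh] Def. 3.3 (ii): `Δ^fil`-coverings and `Δ^fil`-closures EXIST — the predicates `IsFilCovering` /
# `IsFilClosure` INSTANTIATED (generic construction + a non-degenerate kernel instance); proof-only

S. Mochizuki, *The étale theta function and its Frobenioid-theoretic manifestations*, Publ. RIMS **45** (2009)
[MochizukiEtTh2009], Def. 3.3 (ii), PRIMS p. 298 l. 70 – p. 299 l. 47 (PDF pp. 72–73): "Write `Z∞^log → Z^log` for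
the 'universal combinatorial covering' of `Z^log` … [so `Z∞^log → Z^log` corresponds to the subgroup
`Δ^{fil,∞}_i ⊆ Δ^tp_X` …]. Then we shall refer to `Z∞^log → X^log` as a `Δ^fil`-covering of `X^log`. If, moreover,
`Y^log → X^log` is a connected tempered covering, which determines an open subgroup `H ⊆ Δ^tp_X`, and
`Δ^{fil,∞}_{i_H} ⊆ H` is the `Δ^fil`-closure of `H`, then we shall refer to any covering `Z∞^log → Y^log` whose
composite with `Y^log → X^log` is the covering `Z∞^log → X^log` as a `Δ^fil`-closure of `Y^log → X^log`."
[cite: MochizukiEtTh2009, Def 3.3 (ii) p.73]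

abc-iut cell, layer L2; abc-iut-L2-lead R1126 row «DEF33ii-INSTANCE» (the node `EtTh:Def3.3(ii)` was NOT YET
under the count standard R1072 because abc-iut-L2-t3's predicates `IsFilCovering` / `IsFilClosure`
(`TemperedCoverings.lean`) had NO instance in the tree and `TemperedFilterOn X` was inhabited at degenerate `X`
only; census `Sec3Defs-NODE-CENSUS.md`, seat abc-iut-w6-d042 gen 4).  PROOF-ONLY (0 definitions, no instance,
no notation, no `Prop` fact); consumed BY NAME: abc-iut-L2-t3's `TemperedFilter`, `TemperedFilterOn`,
`geometricPart`, `IsFilCovering`, `IsFilClosure` and §0 `IsCofree` / `IsMinimalCofree` (`Conventions.lean`);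
abc-iut-w5-d118's `TemperedFilter.nonempty_of_profinite` (Def. 3.3 (i) at every topologically finitely
generated profinite group); abc-iut-L3-t2's interface `SemiGraphs.TemperedArithmeticGroup` ([SemiAnbd] Ex. 3.10);
the L4 free-profinite toolkit (`isFreeProOn_profiniteCompletion_freeGroup`, `isSlimGroup_of_isFreeProOn`),
abc-iut-w5-d218's `isSlimGroup_subgroup_of_isOpen` / `secondCountableTopology_profiniteCompletion_freeGroup`,
`IsTempered.of_profinite` / `IsTempered.subgroup_of_isClosed`, `infinite_profiniteCompletion_freeGroupTwo`,
`isTopologicallyFinitelyGenerated_profiniteCompletion_freeGroupTwo`.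

WHAT IS PROVED.
* `TemperedFilter.isOpen_closure` — for EVERY tempered filter, `Δ^{fil,∞}_i` is OPEN in `Δ` (it is co-free in the
  open subgroup `Δ^fil_i`, and §0 co-free subgroups are open): the universal combinatorial covering is a
  TEMPERED covering (an open subgroup, of infinite index in general) — print p. 299 l. 15–27.
* `exists_isFilCovering_of_isOpen_delta`, `exists_isFilClosure_of_isOpen_delta` — GENERIC: for every
  `X : TemperedArithmeticGroup K` whose geometric subgroup `Δ^tp_X` is open in `Π^tp_X` (e.g. `G_K` finite),
  every tempered filter `F` on `X^log`, every index `i` and every connected tempered covering `H_Y ⊆ Π^tp_X`,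
  the open subgroup `J := Δ^{fil,∞}_i ⊆ Δ^tp_X ⊆ Π^tp_X` (resp. `i := i_H`) IS a `Δ^fil`-covering (resp. a
  `Δ^fil`-closure of `Y^log → X^log`): `geometricPart J = Δ^{fil,∞}_i` and `J ≤ H_Y` by Def. 3.3 (i)(c).
* `exists_temperedFilterOn_isFilClosure_nontrivial` — INSTANCE with NON-TRIVIAL `Δ`: over any algebraically
  closed `K` (`G_K = 1`, so `Δ^tp_X = Π^tp_X`), at `Π := F̂₂` (free profinite on two generators: tempered, slim,
  Galois-countable — every `TemperedArithmeticGroup` field PROVED), with abc-iut-w5-d118's tempered filter of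
  all characteristic open subgroups, every `H_Y` has a `Δ^fil`-closure; in particular
  `∃ X F H_Y J, Nontrivial Δ^tp_X ∧ IsFilClosure F H_Y J`.

HONEST LABEL.  The instance is the GOOD-REDUCTION / profinite shape: for a profinite `Δ` the minimal co-free
subgroup of `Δ^fil_i` is `Δ^fil_i` itself (`Z∞ = Z`: the dual graph of the special fibre is a tree), and the
arithmetic side is degenerate (`G_K = 1`); it is consistency / non-vacuity evidence for the typed Def. 3.3 (ii)
predicates, not the tempered fundamental group of an actual log curve over a `p`-adic field.  The generic
theorems are the mathematical content (co-free ⇒ open; (i)(c) ⇒ `J ≤ H_Y`).  [EtTh] §3 is refereed pre-IUT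
material; nothing here bears on [IUTchIII] Cor. 3.12; no side taken; typed ≠ proved elsewhere.
-/

noncomputable section

namespace Literature.AnabelianGeometry.EtaleTheta

open Topology

universe u

/-! ### 1. `Δ^{fil,∞}_i` is open -/

namespace TemperedFilter

variable {Δ : Type u} [Group Δ] [TopologicalSpace Δ] (F : TemperedFilter Δ)

/-- **`Δ^{fil,∞}_i` is an OPEN subgroup of `Δ`** (for every tempered filter): it is co-free in `Δ^fil_i` — §0:
co-free subgroups are open — and `Δ^fil_i` is open in `Δ`.  So `Z∞^log → X^log` is a tempered (in general
infinite) covering. [cite: MochizukiEtTh2009, Def 3.3 (ii) p.73] -/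
theorem isOpen_closure (i : F.I) : IsOpen (F.closure i : Set Δ) := by
  haveI := F.normal_closure i
  have h : IsOpen (((F.closure i).subgroupOf (F.fil i) : Subgroup (F.fil i)) : Set (F.fil i)) :=
    (F.isMinimalCofree_closure i).isCofree.isOpen
  have himg := (F.isOpen_fil i).isOpenMap_subtype_val _ h
  have hset : Subtype.val '' (((F.closure i).subgroupOf (F.fil i) : Subgroup (F.fil i)) : Set (F.fil i)) =
      (F.closure i : Set Δ) := by
    ext x
    constructor
    · rintro ⟨y, hy, rfl⟩
      exact (Subgroup.mem_subgroupOf).mp hy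
    · intro hx
      exact ⟨⟨x, F.closure_le i hx⟩, (Subgroup.mem_subgroupOf).mpr hx, rfl⟩
  convert himg using 1
  exact hset.symm

end TemperedFilter

/-! ### 2. Generic: `Δ^fil`-coverings and `Δ^fil`-closures exist whenever `Δ^tp_X` is open in `Π^tp_X` -/

section Generic

variable {K : Type u} [Field K] (X : SemiGraphs.TemperedArithmeticGroup K)

/-- **A `Δ^fil`-covering attached to EVERY index `i`** when `Δ^tp_X ⊆ Π^tp_X` is open: the open subgroup
`J := Δ^{fil,∞}_i` of `Π^tp_X` has geometric part `Δ^{fil,∞}_i`, i.e. `IsFilCovering F i J` ("`Z∞^log → Z^log`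
corresponds to the subgroup `Δ^{fil,∞}_i ⊆ Δ^tp_X`"). [cite: MochizukiEtTh2009, Def 3.3 (ii) p.73] -/
theorem exists_isFilCovering_of_isOpen_delta (hΔ : IsOpen (X.delta : Set X.Pi)) (F : TemperedFilterOn X)
    (i : F.I) : ∃ J : OpenSubgroup X.Pi, IsFilCovering F i J ∧ (J : Subgroup X.Pi) ≤ X.delta := by
  have hJopen : IsOpen (((F.closure i).map X.delta.subtype : Subgroup X.Pi) : Set X.Pi) := by
    rw [Subgroup.coe_map]
    exact hΔ.isOpenMap_subtype_val _ (F.isOpen_closure i)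
  refine ⟨⟨(F.closure i).map X.delta.subtype, hJopen⟩, ⟨?_⟩, Subgroup.map_subtype_le _⟩
  change ((F.closure i).map X.delta.subtype).subgroupOf X.delta = F.closure i
  exact Subgroup.comap_map_eq_self_of_injective (Subgroup.subtype_injective X.delta) (F.closure i)

/-- **A `Δ^fil`-closure of EVERY connected tempered covering `Y^log → X^log`** when `Δ^tp_X ⊆ Π^tp_X` is open:
with `H ⊆ Δ^tp_X` the geometric part of `H_Y` and `i_H` its index (Def. 3.3 (i)(c)), the open subgroup
`J := Δ^{fil,∞}_{i_H} ⊆ Π^tp_X` lies in `H_Y` (`Δ^{fil,∞}_{i_H} ⊆ H`) and is the `Δ^fil`-covering attached to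
`i_H`: `IsFilClosure F H_Y J`. [cite: MochizukiEtTh2009, Def 3.3 (ii) p.73] -/
theorem exists_isFilClosure_of_isOpen_delta (hΔ : IsOpen (X.delta : Set X.Pi)) (F : TemperedFilterOn X)
    (HY : OpenSubgroup X.Pi) : ∃ J : OpenSubgroup X.Pi, IsFilClosure F HY J := by
  obtain ⟨J, hJ, hJΔ⟩ := exists_isFilCovering_of_isOpen_delta X hΔ F (F.indexOf (geometricPart HY))
  refine ⟨J, ⟨?_, hJ⟩⟩
  intro x hx
  have hmem : (⟨x, hJΔ hx⟩ : X.delta) ∈ (geometricPart J : Subgroup X.delta) := (Subgroup.mem_subgroupOf).mpr hx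
  rw [hJ.geometricPart_eq] at hmem
  exact (Subgroup.mem_subgroupOf).mp (F.closure_indexOf_le (geometricPart HY) hmem)

end Generic

/-! ### 3. A non-degenerate instance: `Π := F̂₂` over an algebraically closed base field -/

open Literature.IUT.HodgeTheaters (profiniteCompletion)
open Literature.AlgebraicGeometry.Frobenioids (IsSlimGroup)

/-- **Def. 3.3 (ii) INSTANTIATED with non-trivial `Δ^tp_X`**: over an algebraically closed field `K` (`G_K = 1`)
the free profinite group `Π := F̂₂` on two generators carries the structure of abc-iut-L3-t2's
`TemperedArithmeticGroup K` (tempered, slim, Galois-countable — all PROVED), `Δ^tp_X = Π` is non-trivial and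
carries abc-iut-w5-d118's tempered filter of all characteristic open subgroups, and EVERY connected tempered
covering `H_Y` admits a `Δ^fil`-closure `J` (`IsFilClosure F H_Y J`).  HONEST LABEL: profinite / good-reduction
shape (`Δ^{fil,∞}_i = Δ^fil_i`, `Z∞ = Z`), arithmetic side degenerate. [cite: MochizukiEtTh2009, Def 3.3 (ii) p.73] -/
theorem exists_temperedFilterOn_isFilClosure_nontrivial (K : Type) [Field K] [IsAlgClosed K] :
    ∃ (X : SemiGraphs.TemperedArithmeticGroup K) (F : TemperedFilterOn X),
      Nontrivial X.delta ∧ ∀ HY : OpenSubgroup X.Pi, ∃ J : OpenSubgroup X.Pi, IsFilClosure F HY J := by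
  classical
  -- `G_K = 1` for `K` algebraically closed (`K → K̄` is onto)
  haveI : Subsingleton (Field.absoluteGaloisGroup K) := by
    refine ⟨fun σ τ => AlgEquiv.ext fun x => ?_⟩
    obtain ⟨k, rfl⟩ :=
      (IsAlgClosed.algebraMap_bijective_of_isIntegral (k := K) (K := AlgebraicClosure K)).2 x
    rw [AlgEquiv.commutes, AlgEquiv.commutes]
  -- `Π := F̂₂`
  let P : ProfiniteGrp.{0} := profiniteCompletion (FreeGroup (Fin 2))
  have hfree := AbsoluteAnabelian.isFreeProOn_profiniteCompletion_freeGroup 2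
  have hSlim : IsSlimGroup P := AbsoluteAnabelian.isSlimGroup_of_isFreeProOn ⟨2, _, le_rfl, hfree⟩
  have hT : SemiGraphs.IsTempered P := SemiGraphs.IsTempered.of_profinite
  haveI : SecondCountableTopology P := SemiGraphs.secondCountableTopology_profiniteCompletion_freeGroup (Fin 2)
  let aug : P →ₜ* Field.absoluteGaloisGroup K := 1
  have hker : aug.toMonoidHom.ker = ⊤ := by
    ext x
    simp only [MonoidHom.mem_ker, Subgroup.mem_top, iff_true]
    exact Subsingleton.elim _ _
  have hkerOpen : IsOpen (aug.toMonoidHom.ker : Set P) := by rw [hker]; exact isOpen_univ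
  have hkerClosed : IsClosed (aug.toMonoidHom.ker : Set P) := by rw [hker]; exact isClosed_univ
  let X : SemiGraphs.TemperedArithmeticGroup K :=
    { Pi := P
      isTempered := hT
      aug := aug
      aug_surjective := fun g => ⟨1, Subsingleton.elim _ _⟩
      isTempered_ker := hT.subgroup_of_isClosed _ hkerClosed
      isSlimGroup := hSlim
      isSlimGroup_ker := SemiGraphs.isSlimGroup_subgroup_of_isOpen hSlim _ hkerOpen
      secondCountableTopology := inferInstance }
  have hΔ : X.delta = ⊤ := hker
  have hΔopen : IsOpen (X.delta : Set X.Pi) := hkerOpen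
  -- `Δ = Π = F̂₂`: compact, totally disconnected, topologically finitely generated, infinite
  haveI : CompactSpace X.delta := isCompact_iff_compactSpace.mp hkerClosed.isCompact
  have hmemΔ : ∀ p : P, p ∈ X.delta := fun p => by rw [hΔ]; exact Subgroup.mem_top p
  let e : P ≃ₜ* X.delta :=
    { toFun := fun p => ⟨p, hmemΔ p⟩
      invFun := fun x => x.1
      left_inv := fun _ => rfl
      right_inv := fun _ => rfl
      map_mul' := fun _ _ => rfl
      continuous_toFun := Continuous.subtype_mk continuous_id hmemΔ
      continuous_invFun := continuous_subtype_val }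
  have htfg : AbsoluteAnabelian.IsTopologicallyFinitelyGenerated X.delta :=
    (SemiGraphs.isTopologicallyFinitelyGenerated_profiniteCompletion_freeGroupTwo).of_continuousMulEquiv e
  haveI : Infinite P := SemiGraphs.infinite_profiniteCompletion_freeGroupTwo
  haveI : Infinite X.delta := Infinite.of_injective e e.injective
  obtain ⟨F⟩ := TemperedFilter.nonempty_of_profinite (Δ := X.delta) htfg
  exact ⟨X, F, inferInstance, fun HY => exists_isFilClosure_of_isOpen_delta X hΔopen F HY⟩

/-- **The row's literal target**: `∃ X (F : TemperedFilterOn X) H_Y J, Nontrivial Δ^tp_X ∧ IsFilClosure F H_Y J`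
(at `H_Y := Π^tp_X`, the trivial covering `Y = X`). [cite: MochizukiEtTh2009, Def 3.3 (ii) p.73] -/
theorem exists_isFilClosure_nontrivial (K : Type) [Field K] [IsAlgClosed K] :
    ∃ (X : SemiGraphs.TemperedArithmeticGroup K) (F : TemperedFilterOn X) (HY J : OpenSubgroup X.Pi),
      Nontrivial X.delta ∧ IsFilClosure F HY J := by
  obtain ⟨X, F, hN, h⟩ := exists_temperedFilterOn_isFilClosure_nontrivial K
  obtain ⟨J, hJ⟩ := h ⊤
  exact ⟨X, F, ⊤, J, hN, hJ⟩



end Literature.AnabelianGeometry.EtaleTheta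

end
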